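import Summits.QuantumFields.BalabanUV.Beta.GAN24.WSlotForcingZeroModeW3

/-!
# `BalabanUV.Beta.GAN24.W3ForcingSymZ` — binder row G-an2-4 / (CONV-C), W-slot road «W3» (gan24-p1-g5 `SKELETON-W3.md` v1.0.2 §8.3; END #2
# `WSlotT2OfPieces.t2Drift_of_rows` p213240): **THE FIELD–FIELD CELL CHARGE OF THE FORCING IS THE ONE-STEP DIFFERENCE OF THE SOURCE CHARGES**
# (`zmode N (f m) = zmode N (b (m+1)) − zmode N (b m)`, an IDENTITY — the map half `(𝒜_{m+1} − 𝒜_m)[T♮_m]` is cell zero-mode free with NO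
# hypothesis on the charge of `T♮_m`), HENCE ROW W3-F2b `hZf` IN THE BOND-SYMMETRISED CURRENCY `ZfreeSym` AS A FUNCTION OF ROW W3-F2a IN THAT
# CURRENCY (G-an2-4 formalisation swarm, leaf prover 08 = the ROW W3-F4a∕F4b lineage, gen 20; journal INTENT «W3-F4B-OF-ZS*» l.10226, helper of
# PART 2; module name PROVISIONAL)

NOT IN PRINT; OUR BOOKKEEPING ([folklore]; the engine is leaf-18's: `Lin4ZeroMode.zmode_lin4_sub_lin4_step` (p213341), `WSlotForcingZeroMode`
(p213484: `shape_member`, `locStencil₂_sub`, the `Pi`-vs-lambda bookkeeping of `forcing_zmode_eq_zero_of_source` — reproduced here line for line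
with the two source charges KEPT instead of set to zero), `WSlotForcingZeroModeW3.forcing_translate_block` (p213958); leaf-07's
`WSlotFirstDiff.zmode_add` ∕ `zmode_sub`; leaf-19's `T2SlotCovariance.unitS₂_T2Of_translate`).  ONE-WRITER NOTE: ROW W3-F2b's holder is the leaf-18
lineage (g17 SEAT-CLOSED l.10202, three currencies landed: pointwise ∕ cell ∕ record conjunction); this file only adds the `ZfreeSym` currency that
leaf-12-g21's THIRD REPAIR of the F4d ⊥ (l.10219: `Zfree := ZfreeSym`, `TransportIrrelevantSym` p213864 + `FirstDiffSymCharge` p214319) asks of F2b,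
and yields to a leaf-18 successor on request (rename ∕ absorb welcome).
HONEST FRAMING (cell contract, verbatim): «discharging `BetaPertH` makes Bałaban's UV stability UNCONDITIONAL — a real constructive-QFT result; it is
NOT the continuum limit and NOT the Clay problem.»  HONEST DEPENDENCY (verbatim): «continuum YM on T⁴ ⇐ BetaPertH ∧ nine spine estimates (0/9 proved);
BetaPertH ⇐ (D1) ∧ (D4) ∧ CAP+tail; G-an2-4 gates asym, D1 and NE2/3/4.»

WHAT (generic `d`, `1 ≤ Lc`, ANY period `N` for the charges; `T♮_m := unitS₂ (sfStep Lc m) (smStep d Lc m) (T2Of d Lc cE cVH cΛ cE₂ cB Tc (vh₂S d Lc) mixFF m)`,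
`𝒜_j := lin4 (cE₂·Lc^{2(d+1)}) K♮_j Lc`, a GENERIC source family `b` of `LocStencil₂` tables at one rate `δb > 0`, the forcing
`f m := (𝒜_{m+1} T♮_m − 𝒜_m T♮_m) + (b (m+1) − b m)` in END #2's `Pi` spelling; binders `hmix` (∃-form) and `hmixt` of an2's `BalabanStepW2`):
* **`forcing_zmode_eq_source_sub`** — `zmode N (f m) κ κ′ (inl α) (inl β) = zmode N (b (m+1)) κ κ′ (inl α) (inl β) − zmode N (b m) κ κ′ (inl α) (inl β)`;
* **`forcing_symZ_of_source_symZ`** — if every `b m` has vanishing bond-SYMMETRISED ff charge (`zmode N (b m) κ κ′ ff + zmode N (b m) κ′ κ ff = 0`)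
  then so has every `f m`;
* **`forcing_zfreeSym_of_source`** — with a block-covariant source (`hbcov`): `∀ m, ZfreeSym (f m)` at period `Lc`, i.e. END #2's `hZf` binder at
  `Zfree := ZfreeSym` := `(∀ κ u κ′ u′ t, X κ (u + Lc•t) κ′ (u′ + Lc•t) = shiftK (−Lc•t) (X κ u κ′ u′)) ∧ (∀ κ κ′ κ₁ κ₂, zmode Lc X κ κ′ ff + zmode Lc X κ′ κ ff = 0)`
  (leaf-12's `TransportIrrelevantSym.hTirr_three_symZ_slot` currency), as a function of ROW W3-F2a in the same currency.
HONEST: bookkeeping; ROW W3-F2a (leaf-20, OPEN) is a HYPOTHESIS in whichever currency; NO pin used; asserts NO shape or rate of Bałaban's tables;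
discharges NOTHING of «T2Shape»∕«T2SupRate»∕«T2Drift»∕(hW₂, hW₂all); wall binders: K 2∕2, S 2∕2 are tree theorems at d = 3, Lc ≥ 2, W 0∕2 (this module: reduction only); NOT «W-slot closed», NEVER «G-an2-4 closed», NOT
(CONV-C); NOT `BetaPertH`, NOT continuum, NOT Clay.  0 cited facts, 0 `def`, 0 `def … : Prop`, 0 sorry.
Unit `b2b-balaban-gan24-formalise-leaf-08` (G-an2-4 formalisation swarm, leaf prover 08, gen 20), 2026-08-20.
-/

noncomputable section

open Finset
open scoped BigOperators
open Literature.MathematicalPhysics.QuantumFieldTheory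
open Literature.MathematicalPhysics.QuantumFieldTheory.Balaban1983to89
open Literature.MathematicalPhysics.QuantumFieldTheory.Balaban1983to89.Beta
open ExpKernelCalculus (MKer Decays shiftK)
open OneStepResolventKernel (Fib)
open OneStepKernelFamily (KInvStep decays_KInvStep)
open BalabanCompositeJets (LocStencil₂)
open SecondOrderResponse (LocStencilFM)
open BalabanStepW2 (T2Of)
open AveragingMixedJetTables (vh₂S)
open Summit.QuantumFields.BalabanUV.Beta.HessKerDressedUnits (unitK decays_unitK)
open Summit.QuantumFields.BalabanUV.Beta.SecondOrderUnits (unitS₂)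
open Summit.QuantumFields.BalabanUV.Beta.GAN24.CombesThomas (sfStep smStep)
open Summit.QuantumFields.BalabanUV.Beta.GAN24.T2RecursionAffine (lin4)
open Summit.QuantumFields.BalabanUV.Beta.GAN24.BiStencilZeroMode (Tab zmode)
open Summit.QuantumFields.BalabanUV.Beta.GAN24.T2SlotCovariance (unitS₂_T2Of_translate)
open Summit.QuantumFields.BalabanUV.Beta.GAN24.WSlotFirstDiff (zmode_add zmode_sub)
open Summit.QuantumFields.BalabanUV.Beta.GAN24.Lin4ZeroMode (locStencil₂_lin4 zmode_lin4_sub_lin4_step)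
open Summit.QuantumFields.BalabanUV.Beta.GAN24.WSlotForcingZeroMode (shape_member locStencil₂_sub)
open Summit.QuantumFields.BalabanUV.Beta.GAN24.WSlotForcingZeroModeW3 (forcing_translate_block)

namespace Summit.QuantumFields.BalabanUV.Beta.GAN24.W3ForcingSymZ

variable {d : ℕ} {Lc : ℕ} [NeZero Lc]

/-- **THE CELL ff CHARGE OF THE FORCING = THE ONE-STEP DIFFERENCE OF THE SOURCE CHARGES** [folklore identity]: at any period `N`,
`zmode N ((𝒜_{m+1} T♮_m − 𝒜_m T♮_m) + (b (m+1) − b m)) κ κ′ (inl α) (inl β) = zmode N (b (m+1)) κ κ′ (inl α) (inl β) − zmode N (b m) κ κ′ (inl α) (inl β)`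
— the map difference is cell zero-mode free for EVERY jointly `Lc`-covariant `LocStencil₂` argument (leaf-18's `Lin4ZeroMode.zmode_lin4_sub_lin4_step`,
no pin, no hypothesis on the charge of `T♮_m`), and `zmode` is additive on `LocStencil₂` tables (leaf-07).  Leaf-18's
`WSlotForcingZeroMode.forcing_zmode_eq_zero_of_source` is the case `zmode N (b ·) ff = 0`. -/
theorem forcing_zmode_eq_source_sub (hLc : 1 ≤ Lc) (N : ℕ) (cE cVH cΛ cE₂ cB : ℝ) (Tc : Fin 4 → Fin 4 → Fin 4 → Fin 4 → ℝ)
    {mixFF : Tab d} (hmix : ∃ C δ : ℝ, 0 < δ ∧ LocStencilFM Lc mixFF C δ)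
    (hmixt : ∀ (κ : Fin (d + 1)) (u : Fin (d + 1) → ℤ) (ρ : Fin (d + 1)) (w t : Fin (d + 1) → ℤ),
      mixFF κ (u + (Lc : ℤ) • t) ρ (w + t) = shiftK (-((Lc : ℤ) • t)) (mixFF κ u ρ w))
    (b : ℕ → Tab d) {Cb δb : ℝ} (hδb : 0 < δb) (hb : ∀ m, LocStencil₂ (b m) Cb δb)
    (m : ℕ) (κ κ' α β : Fin (d + 1)) :
    zmode N
      ((lin4 (cE₂ * (Lc : ℝ) ^ (2 * (d + 1))) (unitK (sfStep Lc (m + 1)) (smStep d Lc (m + 1)) (KInvStep (d := d) Lc (m + 1))) Lc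
            (unitS₂ (sfStep Lc m) (smStep d Lc m) (T2Of d Lc cE cVH cΛ cE₂ cB Tc (vh₂S d Lc) mixFF m))
          - lin4 (cE₂ * (Lc : ℝ) ^ (2 * (d + 1))) (unitK (sfStep Lc m) (smStep d Lc m) (KInvStep (d := d) Lc m)) Lc
            (unitS₂ (sfStep Lc m) (smStep d Lc m) (T2Of d Lc cE cVH cΛ cE₂ cB Tc (vh₂S d Lc) mixFF m)))
        + (b (m + 1) - b m)) κ κ' (Sum.inl α) (Sum.inl β)
      = zmode N (b (m + 1)) κ κ' (Sum.inl α) (Sum.inl β) - zmode N (b m) κ κ' (Sum.inl α) (Sum.inl β) := by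
  obtain ⟨CT, δT, hδT, hT⟩ := shape_member hLc cE cVH cΛ cE₂ cB Tc hmix m
  have hTcov := fun κ u κ' u' t => unitS₂_T2Of_translate hLc cE cVH cΛ cE₂ cB Tc hmixt m κ u κ' u' t
  obtain ⟨mi, Ci, hmi, hCi, hKi⟩ := decays_KInvStep (Lc := Lc) (d := d) (m + 1)
  obtain ⟨mj, Cj, hmj, hCj, hKj⟩ := decays_KInvStep (Lc := Lc) (d := d) m
  have hLi := locStencil₂_lin4 (decays_unitK (sf := sfStep Lc (m + 1)) (sm := smStep d Lc (m + 1)) hKi) (by positivity) hmi hLc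
    (cE₂ * (Lc : ℝ) ^ (2 * (d + 1))) hT hδT
  have hLj := locStencil₂_lin4 (decays_unitK (sf := sfStep Lc m) (sm := smStep d Lc m) hKj) (by positivity) hmj hLc
    (cE₂ * (Lc : ℝ) ^ (2 * (d + 1))) hT hδT
  set r : ℝ := min (min (min mi δT / 128) (min mj δT / 128)) δb with hr_def
  have hr : 0 < r := by rw [hr_def]; positivity
  have hr1 : r ≤ min mi δT / 128 := by rw [hr_def]; exact (min_le_left _ _).trans (min_le_left _ _)
  have hr2 : r ≤ min mj δT / 128 := by rw [hr_def]; exact (min_le_left _ _).trans (min_le_right _ _)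
  have hr3 : r ≤ δb := by rw [hr_def]; exact min_le_right _ _
  have hA := locStencil₂_sub (hLi.mono hr1) (hLj.mono hr2)
  have hS := locStencil₂_sub ((hb (m + 1)).mono hr3) ((hb m).mono hr3)
  have e1 := zmode_add (N := N) hA hS hr κ κ' (Sum.inl α) (Sum.inl β)
  have e2 := zmode_sub (N := N) ((hb (m + 1)).mono hr3) ((hb m).mono hr3) hr κ κ' (Sum.inl α) (Sum.inl β)
  have e3 := zmode_lin4_sub_lin4_step hLc N (m + 1) m (cE₂ * (Lc : ℝ) ^ (2 * (d + 1))) hT hδT hTcov κ κ' α β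
  -- the END's `Pi` spelling versus the lambda spelling of `zmode_add`∕`zmode_sub`: definitionally equal
  have eA : zmode N ((lin4 (cE₂ * (Lc : ℝ) ^ (2 * (d + 1)))
        (unitK (sfStep Lc (m + 1)) (smStep d Lc (m + 1)) (KInvStep (d := d) Lc (m + 1))) Lc
          (unitS₂ (sfStep Lc m) (smStep d Lc m) (T2Of d Lc cE cVH cΛ cE₂ cB Tc (vh₂S d Lc) mixFF m))
        - lin4 (cE₂ * (Lc : ℝ) ^ (2 * (d + 1))) (unitK (sfStep Lc m) (smStep d Lc m) (KInvStep (d := d) Lc m)) Lc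
          (unitS₂ (sfStep Lc m) (smStep d Lc m) (T2Of d Lc cE cVH cΛ cE₂ cB Tc (vh₂S d Lc) mixFF m)))
        + (b (m + 1) - b m)) κ κ' (Sum.inl α) (Sum.inl β) = _ := e1
  have eS : zmode N (b (m + 1) - b m) κ κ' (Sum.inl α) (Sum.inl β) = _ := e2
  rw [eA, e3, eS, zero_add]

/-- **VANISHING BOND-SYMMETRISED ff CHARGE PASSES FROM THE SOURCES TO THE FORCING** [folklore]: if
`zmode N (b m) κ κ′ ff + zmode N (b m) κ′ κ ff = 0` for all `m`, then the same holds for every `f m` (by `forcing_zmode_eq_source_sub` twice). -/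
theorem forcing_symZ_of_source_symZ (hLc : 1 ≤ Lc) (N : ℕ) (cE cVH cΛ cE₂ cB : ℝ) (Tc : Fin 4 → Fin 4 → Fin 4 → Fin 4 → ℝ)
    {mixFF : Tab d} (hmix : ∃ C δ : ℝ, 0 < δ ∧ LocStencilFM Lc mixFF C δ)
    (hmixt : ∀ (κ : Fin (d + 1)) (u : Fin (d + 1) → ℤ) (ρ : Fin (d + 1)) (w t : Fin (d + 1) → ℤ),
      mixFF κ (u + (Lc : ℤ) • t) ρ (w + t) = shiftK (-((Lc : ℤ) • t)) (mixFF κ u ρ w))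
    (b : ℕ → Tab d) {Cb δb : ℝ} (hδb : 0 < δb) (hb : ∀ m, LocStencil₂ (b m) Cb δb)
    (hZ : ∀ (m : ℕ) (κ κ' α β : Fin (d + 1)),
      zmode N (b m) κ κ' (Sum.inl α) (Sum.inl β) + zmode N (b m) κ' κ (Sum.inl α) (Sum.inl β) = 0)
    (m : ℕ) (κ κ' α β : Fin (d + 1)) :
    zmode N
        ((lin4 (cE₂ * (Lc : ℝ) ^ (2 * (d + 1))) (unitK (sfStep Lc (m + 1)) (smStep d Lc (m + 1)) (KInvStep (d := d) Lc (m + 1))) Lc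
              (unitS₂ (sfStep Lc m) (smStep d Lc m) (T2Of d Lc cE cVH cΛ cE₂ cB Tc (vh₂S d Lc) mixFF m))
            - lin4 (cE₂ * (Lc : ℝ) ^ (2 * (d + 1))) (unitK (sfStep Lc m) (smStep d Lc m) (KInvStep (d := d) Lc m)) Lc
              (unitS₂ (sfStep Lc m) (smStep d Lc m) (T2Of d Lc cE cVH cΛ cE₂ cB Tc (vh₂S d Lc) mixFF m)))
          + (b (m + 1) - b m)) κ κ' (Sum.inl α) (Sum.inl β)
      + zmode N
        ((lin4 (cE₂ * (Lc : ℝ) ^ (2 * (d + 1))) (unitK (sfStep Lc (m + 1)) (smStep d Lc (m + 1)) (KInvStep (d := d) Lc (m + 1))) Lc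
              (unitS₂ (sfStep Lc m) (smStep d Lc m) (T2Of d Lc cE cVH cΛ cE₂ cB Tc (vh₂S d Lc) mixFF m))
            - lin4 (cE₂ * (Lc : ℝ) ^ (2 * (d + 1))) (unitK (sfStep Lc m) (smStep d Lc m) (KInvStep (d := d) Lc m)) Lc
              (unitS₂ (sfStep Lc m) (smStep d Lc m) (T2Of d Lc cE cVH cΛ cE₂ cB Tc (vh₂S d Lc) mixFF m)))
          + (b (m + 1) - b m)) κ' κ (Sum.inl α) (Sum.inl β) = 0 := by
  rw [forcing_zmode_eq_source_sub hLc N cE cVH cΛ cE₂ cB Tc hmix hmixt b hδb hb m κ κ' α β,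
    forcing_zmode_eq_source_sub hLc N cE cVH cΛ cE₂ cB Tc hmix hmixt b hδb hb m κ' κ α β]
  have h1 := hZ (m + 1) κ κ' α β
  have h0 := hZ m κ κ' α β
  linarith

/-- **ROW W3-F2b IN THE `ZfreeSym` CURRENCY AS A FUNCTION OF ROW W3-F2a IN THAT CURRENCY, GENERIC SOURCE** [folklore composition]: for a
block-covariant (`hbcov`) source family `b` of `LocStencil₂` tables with vanishing bond-symmetrised ff charges at period `Lc`, every forcing `f m`
satisfies END #2's `hZf` binder at `Zfree := ZfreeSym` — covariance conjunct by leaf-18's `WSlotForcingZeroModeW3.forcing_translate_block`, charge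
conjunct by `forcing_symZ_of_source_symZ`. -/
theorem forcing_zfreeSym_of_source (hLc : 1 ≤ Lc) (cE cVH cΛ cE₂ cB : ℝ) (Tc : Fin 4 → Fin 4 → Fin 4 → Fin 4 → ℝ)
    {mixFF : Tab d} (hmix : ∃ C δ : ℝ, 0 < δ ∧ LocStencilFM Lc mixFF C δ)
    (hmixt : ∀ (κ : Fin (d + 1)) (u : Fin (d + 1) → ℤ) (ρ : Fin (d + 1)) (w t : Fin (d + 1) → ℤ),
      mixFF κ (u + (Lc : ℤ) • t) ρ (w + t) = shiftK (-((Lc : ℤ) • t)) (mixFF κ u ρ w))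
    (b : ℕ → Tab d)
    (hbcov : ∀ (m : ℕ) (κ : Fin (d + 1)) (u : Fin (d + 1) → ℤ) (κ' : Fin (d + 1)) (u' t : Fin (d + 1) → ℤ),
      b m κ (u + (Lc : ℤ) • t) κ' (u' + (Lc : ℤ) • t) = shiftK (-((Lc : ℤ) • t)) (b m κ u κ' u'))
    {Cb δb : ℝ} (hδb : 0 < δb) (hb : ∀ m, LocStencil₂ (b m) Cb δb)
    (hZ : ∀ (m : ℕ) (κ κ' α β : Fin (d + 1)),
      zmode Lc (b m) κ κ' (Sum.inl α) (Sum.inl β) + zmode Lc (b m) κ' κ (Sum.inl α) (Sum.inl β) = 0)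
    (m : ℕ) :
    (∀ (κ : Fin (d + 1)) (u : Fin (d + 1) → ℤ) (κ' : Fin (d + 1)) (u' t : Fin (d + 1) → ℤ),
      (((lin4 (cE₂ * (Lc : ℝ) ^ (2 * (d + 1))) (unitK (sfStep Lc (m + 1)) (smStep d Lc (m + 1)) (KInvStep (d := d) Lc (m + 1))) Lc
              (unitS₂ (sfStep Lc m) (smStep d Lc m) (T2Of d Lc cE cVH cΛ cE₂ cB Tc (vh₂S d Lc) mixFF m))
            - lin4 (cE₂ * (Lc : ℝ) ^ (2 * (d + 1))) (unitK (sfStep Lc m) (smStep d Lc m) (KInvStep (d := d) Lc m)) Lc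
              (unitS₂ (sfStep Lc m) (smStep d Lc m) (T2Of d Lc cE cVH cΛ cE₂ cB Tc (vh₂S d Lc) mixFF m)))
          + (b (m + 1) - b m))) κ (u + (Lc : ℤ) • t) κ' (u' + (Lc : ℤ) • t)
        = shiftK (-((Lc : ℤ) • t))
          ((((lin4 (cE₂ * (Lc : ℝ) ^ (2 * (d + 1))) (unitK (sfStep Lc (m + 1)) (smStep d Lc (m + 1)) (KInvStep (d := d) Lc (m + 1))) Lc
                  (unitS₂ (sfStep Lc m) (smStep d Lc m) (T2Of d Lc cE cVH cΛ cE₂ cB Tc (vh₂S d Lc) mixFF m))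
                - lin4 (cE₂ * (Lc : ℝ) ^ (2 * (d + 1))) (unitK (sfStep Lc m) (smStep d Lc m) (KInvStep (d := d) Lc m)) Lc
                  (unitS₂ (sfStep Lc m) (smStep d Lc m) (T2Of d Lc cE cVH cΛ cE₂ cB Tc (vh₂S d Lc) mixFF m)))
              + (b (m + 1) - b m))) κ u κ' u')) ∧
    (∀ (κ κ' κ₁ κ₂ : Fin (d + 1)),
      zmode Lc
          ((lin4 (cE₂ * (Lc : ℝ) ^ (2 * (d + 1))) (unitK (sfStep Lc (m + 1)) (smStep d Lc (m + 1)) (KInvStep (d := d) Lc (m + 1))) Lc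
                (unitS₂ (sfStep Lc m) (smStep d Lc m) (T2Of d Lc cE cVH cΛ cE₂ cB Tc (vh₂S d Lc) mixFF m))
              - lin4 (cE₂ * (Lc : ℝ) ^ (2 * (d + 1))) (unitK (sfStep Lc m) (smStep d Lc m) (KInvStep (d := d) Lc m)) Lc
                (unitS₂ (sfStep Lc m) (smStep d Lc m) (T2Of d Lc cE cVH cΛ cE₂ cB Tc (vh₂S d Lc) mixFF m)))
            + (b (m + 1) - b m)) κ κ' (Sum.inl κ₁) (Sum.inl κ₂)
        + zmode Lc
          ((lin4 (cE₂ * (Lc : ℝ) ^ (2 * (d + 1))) (unitK (sfStep Lc (m + 1)) (smStep d Lc (m + 1)) (KInvStep (d := d) Lc (m + 1))) Lc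
                (unitS₂ (sfStep Lc m) (smStep d Lc m) (T2Of d Lc cE cVH cΛ cE₂ cB Tc (vh₂S d Lc) mixFF m))
              - lin4 (cE₂ * (Lc : ℝ) ^ (2 * (d + 1))) (unitK (sfStep Lc m) (smStep d Lc m) (KInvStep (d := d) Lc m)) Lc
                (unitS₂ (sfStep Lc m) (smStep d Lc m) (T2Of d Lc cE cVH cΛ cE₂ cB Tc (vh₂S d Lc) mixFF m)))
            + (b (m + 1) - b m)) κ' κ (Sum.inl κ₁) (Sum.inl κ₂) = 0) :=
  ⟨fun κ u κ' u' t => forcing_translate_block hLc cE cVH cΛ cE₂ cB Tc hmixt b hbcov m κ u κ' u' t,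
    fun κ κ' κ₁ κ₂ => forcing_symZ_of_source_symZ hLc Lc cE cVH cΛ cE₂ cB Tc hmix hmixt b hδb hb hZ m κ κ' κ₁ κ₂⟩

end Summit.QuantumFields.BalabanUV.Beta.GAN24.W3ForcingSymZ

end
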